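import Literature.AlgebraicGeometry.Frobenioids.MotivatingExamplesSub
import Literature.AlgebraicGeometry.Frobenioids.GeometricFrobenioidStandard
import HarnessLib

/-!
# Frobenioids I, §6 sub-DAG, row T62ii/L03 `Thm62_geomHypotheses`: the EXACT dependence on the base category —
# the hypotheses of Thm. 5.2 hold for every interface datum `Γ` iff `D = B(G)⁰` is of FSM-type

Mochizuki, *The geometry of Frobenioids I: the general theory*, Kyushu J. Math. **62** (2008) 293–400,
Example 6.1 p. 109 ("`K̃` a Galois extension of `K` … the assignments `L ↦ Φ(L)`, `L ↦ B(L)` determine … monoids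
on `D`"), Def. 1.1 (ii) p. 19 (a monoid on `D`: pull-backs characteristically injective, and bijective along
FSM-morphisms), proof of Thm. 6.2 (iii) p. 111 ("It is immediate that every monomorphism of `D` is an
isomorphism, hence that `D` is of FSM-type") [cite: MochizukiFrdI2008, Ex. 6.1 p.109]
[cite: MochizukiFrdI2008, Thm. 6.2 (iii) p.111].

PROOF-ONLY companion (cell abc-iut, block F, seat abc-iut-f-043; supports FACT-LIST row F-1133, whose universal
closure AS TYPED — arbitrary `K̃/K` — is refuted in `MotivatingExamplesSubGeomHypothesesClosure.lean` and whose
printed instance form — `K̃/K` Galois — is abc-iut-L6-t10's `Thm62_geomHypotheses_holds`). No definitions. This file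
locates the dependence EXACTLY, over an arbitrary extension `Kt/K`:

* `geom_hypotheses_of_isOfFSMType` / `Thm62_geomHypotheses_of_isOfFSMType` — if `D = FinSubextCat K Kt` is of
  FSM-type (the property the printed proofs actually invoke, p. 111 / p. 115), then the hypotheses of Thm. 5.2
  hold for EVERY `Γ : GeometricDivisorData K Kt`; the Galois case is the instance `FinSubextCat.isOfFSMType`
  (abc-iut-L6-t10), so this generalises `geom_hypotheses` / `Thm62_geomHypotheses_holds` (same argument:
  `Φ`-pull-backs are injective into sharp monoids, `B`-maps are restrictions of field homomorphisms, and an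
  FSM-morphism is an isomorphism; `D` is connected and totally epimorphic for any `Kt/K`);
* `exists_not_Thm62_geomHypotheses_of_not_isOfFSMType` — conversely, if `D` is NOT of FSM-type, i.e. some
  FSM-morphism `σ : Spec L → Spec M` is not an isomorphism (the field map `M → L` is not onto, so
  `[L : K] > [M : K]`), then the admissible interface datum `Γ_σ` (one prime divisor everywhere, ramification `1`,
  `B = 1`, `Φ(N) = 2ℤ_{≥0}` when `[N : K] ≤ [M : K]` and `ℤ_{≥0}` otherwise — saturated, `ℚ`-Cartier, functorial)
  violates Def. 1.1 (ii)(b) at `σ`: `1 ∈ Φ(L)` is not pulled back from `Φ(M) = 2ℤ_{≥0}`;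
* `forall_Thm62_geomHypotheses_iff_isOfFSMType` — hence **`(∀ Γ, Thm62_geomHypotheses Γ) ↔ D` of FSM-type**.

Consumers may therefore replace `[IsGalois K Kt]` by `IsOfFSMType (FinSubextCat K Kt)`. Nothing here bears on
[IUTchIII] Cor. 3.12 or asserts anything about abc.
-/

namespace Literature.AlgebraicGeometry.Frobenioids

open CategoryTheory Opposite Function

variable {K : Type} [Field K] {Kt : Type} [Field Kt] [Algebra K Kt]

/-! ### FSM-type of `D` suffices (every `Γ`) -/

/-- The underlying map of an isomorphism of `CommMonCat` is bijective. [cite: MochizukiFrdI2008, Def. 1.1 (ii) p.19] -/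
private theorem bijective_hom_of_isIso_fsm {X Y : CommMonCat.{0}} (f : X ⟶ Y) [IsIso f] :
    Bijective f.hom := by
  refine bijective_iff_has_inverse.mpr ⟨(inv f).hom, fun x => ?_, fun y => ?_⟩
  · change (f ≫ inv f).hom x = x
    rw [IsIso.hom_inv_id]
    rfl
  · change (inv f ≫ f).hom y = y
    rw [IsIso.inv_hom_id]
    rfl

/-- **Example 6.1: `Φ` is a monoid on `D`** for every `Γ`, as soon as `D = FinSubextCat K Kt` is of FSM-type
(Def. 1.1 (ii): pull-backs are injective — `pullPhi_injective` — into sharp monoids, hence characteristically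
injective; an FSM-morphism is an isomorphism, so its pull-back is bijective). Generalises abc-iut-L6-t10's
`geomDivisorFunctor_isMonoidOn` (`K̃/K` Galois). [cite: MochizukiFrdI2008, Ex. 6.1 p.109] -/
theorem geomDivisorFunctor_isMonoidOn_of_isOfFSMType (hD : IsOfFSMType (FinSubextCat K Kt))
    (Γ : GeometricDivisorData K Kt) : IsMonoidOn (geomDivisorFunctor Γ) := by
  refine ⟨fun {X Y} σ => ?_, fun {X Y} σ hσ => ?_⟩
  · have hinj : Injective (pull (geomDivisorFunctor Γ) σ) := Γ.pullPhi_injective σ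
    refine ⟨hinj, fun x y hxy => ?_⟩
    obtain ⟨a, rfl⟩ := Associates.mk_surjective x
    obtain ⟨b, rfl⟩ := Associates.mk_surjective y
    rw [associatesMap_mk, associatesMap_mk, Associates.mk_eq_mk_iff_associated] at hxy
    obtain ⟨w, hw⟩ := hxy
    have hw1 : (w : (geomDivisorFunctor Γ).obj (op Y)) = 1 := (Γ.isSharp_phi Y).1 _ w.isUnit
    rw [hw1, mul_one] at hw
    rw [hinj hw]
  · haveI : IsIso σ := hD.isIso_of_isFSM σ hσ
    haveI : IsIso ((geomDivisorFunctor Γ).map σ.op) := inferInstance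
    exact bijective_hom_of_isIso_fsm ((geomDivisorFunctor Γ).map σ.op)

/-- **Example 6.1: `B` is a monoid on `D`** for every `Γ`, as soon as `D` is of FSM-type (`B(M) → B(L)` is the
restriction of a field homomorphism, injective, `B` group-like so characteristics are trivial; FSM-morphisms are
isomorphisms). Generalises abc-iut-L6-t10's `geomUnitsFunctor_isMonoidOn`. [cite: MochizukiFrdI2008, Ex. 6.1 p.109] -/
theorem geomUnitsFunctor_isMonoidOn_of_isOfFSMType (hD : IsOfFSMType (FinSubextCat K Kt))
    (Γ : GeometricDivisorData K Kt) : IsMonoidOn (geomUnitsFunctor Γ) := by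
  refine ⟨fun {X Y} σ => ?_, fun {X Y} σ hσ => ?_⟩
  · refine ⟨fun f g hfg => ?_, ?_⟩
    · have h := congrArg (fun u : Γ.B Y => (((u : Γ.B Y) : (Y.L)ˣ) : Y.L)) hfg
      change (((Γ.mapB σ f : Γ.B Y) : (Y.L)ˣ) : Y.L) = (((Γ.mapB σ g : Γ.B Y) : (Y.L)ˣ) : Y.L) at h
      rw [GeometricDivisorData.coe_mapB, GeometricDivisorData.coe_mapB] at h
      exact Subtype.ext (Units.ext ((σ.toAlgHom : X.L →+* Y.L).injective h))
    · haveI : Subsingleton (Associates ((geomUnitsFunctor Γ).obj (op X))) :=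
        (geomUnitsFunctor_isGroupLike Γ X).subsingleton_associates
      exact injective_of_subsingleton _
  · haveI : IsIso σ := hD.isIso_of_isFSM σ hσ
    haveI : IsIso ((geomUnitsFunctor Γ).map σ.op) := inferInstance
    exact bijective_hom_of_isIso_fsm ((geomUnitsFunctor Γ).map σ.op)

/-- **The hypotheses of Thm. 5.2 for `(Φ, B)` of Ex. 6.1 hold for EVERY `Γ` once `D` is of FSM-type** — `Φ(L)`
divisorial by saturation (v4 `sub_mem`), `B` group-like, `D` connected and totally epimorphic (any `Kt/K`).
Generalises `geom_hypotheses` (Galois case = `FinSubextCat.isOfFSMType K Kt`). [cite: MochizukiFrdI2008, Ex. 6.1 p.109] -/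
theorem geom_hypotheses_of_isOfFSMType (hD : IsOfFSMType (FinSubextCat K Kt)) (Γ : GeometricDivisorData K Kt) :
    ModelFrobenioid.Hypotheses (geomDivisorFunctor Γ) (geomUnitsFunctor Γ) where
  isMonoidOn := geomDivisorFunctor_isMonoidOn_of_isOfFSMType hD Γ
  isDivisorial X := Γ.isDivisorial_phi_of_sub_mem X (Γ.sub_mem X)
  isMonoidOn_rat := geomUnitsFunctor_isMonoidOn_of_isOfFSMType hD Γ
  isGroupLike_rat := geomUnitsFunctor_isGroupLike Γ
  isGraphConnected := FinSubextCat.isGraphConnected K Kt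
  isTotallyEpimorphic := FinSubextCat.isTotallyEpimorphic K Kt

/-- **T62ii/L03 for every `Γ` from FSM-type of `D` alone** (no Galois hypothesis).
[cite: MochizukiFrdI2008, Ex. 6.1 p.109] -/
theorem Thm62_geomHypotheses_of_isOfFSMType (hD : IsOfFSMType (FinSubextCat K Kt))
    (Γ : GeometricDivisorData K Kt) : Thm62_geomHypotheses Γ :=
  geom_hypotheses_of_isOfFSMType hD Γ

/-! ### FSM-type of `D` is necessary (some `Γ` fails otherwise) -/

/-- **If `D = FinSubextCat K Kt` is not of FSM-type, some admissible interface datum violates T62ii/L03.** Take an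
FSM-morphism `σ : Spec L → Spec M` that is not an isomorphism; its field map `M → L` is injective but not
surjective, so `[L : K] ≤ [M : K]` fails. The datum `Γ_σ` — `D_N = {pt}`, `Φ(N) = {D | [N : K] ≤ [M : K] → D(pt)
even}` (an additive, saturated, `ℚ`-Cartier submonoid, functorial because degrees grow along arrows), `B(N) = 1`,
identity `over`, ramification `1` — satisfies every axiom of `GeometricDivisorData` (v4), and `1 ∈ Φ(L)` has no
`σ^*`-preimage in `Φ(M)`, contradicting Def. 1.1 (ii)(b) inside `ModelFrobenioid.Hypotheses.isMonoidOn`.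
[cite: MochizukiFrdI2008, Thm. 6.2 (iii) p.111] -/
theorem exists_not_Thm62_geomHypotheses_of_not_isOfFSMType (hD : ¬ IsOfFSMType (FinSubextCat K Kt)) :
    ∃ Γ : GeometricDivisorData K Kt, ¬ Thm62_geomHypotheses Γ := by
  -- an FSM-morphism σ : X ⟶ Y (field map Y.L → X.L) that is not an isomorphism
  obtain ⟨X, Y, σ, hσ, hnot⟩ : ∃ (X Y : FinSubextCat K Kt) (σ : X ⟶ Y), IsFSM σ ∧ ¬ IsIso σ := by
    by_contra hc
    refine hD ⟨fun {A B} f hf => ?_⟩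
    by_contra hf'
    exact hc ⟨A, B, f, hf, hf'⟩
  -- its field map is not surjective, so the degree of X exceeds that of Y
  have hns : ¬ Module.finrank K X.L ≤ Module.finrank K Y.L := by
    intro hle
    have heq : Module.finrank K Y.L = Module.finrank K X.L :=
      le_antisymm (LinearMap.finrank_le_finrank_of_injective (f := σ.toAlgHom.toLinearMap)
        (σ.toAlgHom : Y.L →+* X.L).injective) hle
    have hsurj : Surjective σ.toAlgHom.toLinearMap :=
      (LinearMap.injective_iff_surjective_of_finrank_eq_finrank heq).mp (σ.toAlgHom : Y.L →+* X.L).injective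
    have hbij : Bijective σ.toAlgHom := ⟨(σ.toAlgHom : Y.L →+* X.L).injective, fun y => hsurj y⟩
    exact hnot (FinSubextCat.isIso_of_bijective σ hbij)
  -- the datum Γ_σ
  let Γ : GeometricDivisorData K Kt :=
    { primeDiv := fun _ => Unit
      Phi := fun N =>
        { carrier := {D | Module.finrank K N.L ≤ Module.finrank K Y.L → Even (D ())}
          zero_mem' := fun _ => ⟨0, rfl⟩
          add_mem' := fun {D E} hDm hEm hN => by
            rw [Finsupp.add_apply]
            exact (hDm hN).add (hEm hN) }
      B := fun _ => ⊥
      div := fun _ => 1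
      over := fun _ Q => Q
      ram := fun _ _ => 1
      ram_pos := fun _ _ => Nat.one_pos
      over_finite := fun _ _ => Set.toFinite _
      over_surjective := fun _ => Function.surjective_id
      over_id := fun _ _ => rfl
      ram_id := fun _ _ => rfl
      over_comp := fun _ _ _ => rfl
      ram_comp := fun _ _ _ => rfl
      pull_mem := fun {N M} τ D hDm hM => by
        rw [DivisorCoeff.pull_apply, Nat.cast_one, one_mul]
        exact hDm ((LinearMap.finrank_le_finrank_of_injective (f := τ.toAlgHom.toLinearMap)
          (τ.toAlgHom : N.L →+* M.L).injective).trans hM)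
      map_mem := fun τ f hf => by
        rw [Subgroup.mem_bot] at hf ⊢
        rw [hf, map_one]
      div_natural := fun τ f => by simp
      div_mem_gp := fun N f => ⟨0, zero_mem _, 0, zero_mem _, by simp⟩
      qCartier := fun N P => ⟨2, two_pos, fun _ => by rw [Finsupp.single_eq_same]; exact ⟨1, rfl⟩⟩
      sub_mem := fun N D E hDm hEm hle hN => by
        rw [Finsupp.tsub_apply]
        exact (Nat.even_sub (hle ())).mpr (iff_of_true (hDm hN) (hEm hN))
      primeDiv_nonempty := ⟨Y, ⟨()⟩⟩ }
  refine ⟨Γ, fun h => ?_⟩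
  have hbij := h.isMonoidOn.bijective_of_isFSM σ hσ
  have hmem : (Finsupp.single () 1 : Unit →₀ ℕ) ∈ Γ.Phi X := fun hle => (hns hle).elim
  obtain ⟨x, hx⟩ := hbij.2 (Multiplicative.ofAdd ⟨Finsupp.single () 1, hmem⟩)
  have hx1 : ((Multiplicative.toAdd x : Γ.Phi Y) : Unit →₀ ℕ) () = 1 := by
    have h' := congrArg (fun z => ((Multiplicative.toAdd z : Γ.Phi X) : Unit →₀ ℕ) ()) hx
    change ((1 : ℕ) : ℕ) * ((Multiplicative.toAdd x : Γ.Phi Y) : Unit →₀ ℕ) () =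
      (Finsupp.single () 1 : Unit →₀ ℕ) () at h'
    rwa [one_mul, Finsupp.single_eq_same] at h'
  have heven : Even (((Multiplicative.toAdd x : Γ.Phi Y) : Unit →₀ ℕ) ()) :=
    (Multiplicative.toAdd x).2 le_rfl
  rw [hx1] at heven
  exact Nat.not_even_one heven

/-- **T62ii/L03 `Thm62_geomHypotheses`: exact dependence on the base category.** Over an arbitrary extension
`Kt/K`, the hypotheses of Thm. 5.2 for the data of Ex. 6.1 hold for EVERY interface datum `Γ` if and only if
`D = FinSubextCat K Kt` is of FSM-type (print, p. 111: "every monomorphism of `D` is an isomorphism, hence `D`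
is of FSM-type" — true for `K̃/K` Galois, `FinSubextCat.isOfFSMType`; false e.g. for `ℝ/ℚ`,
`not_forall_Thm62_geomHypotheses`). [cite: MochizukiFrdI2008, Thm. 6.2 (iii) p.111] -/
theorem forall_Thm62_geomHypotheses_iff_isOfFSMType :
    (∀ Γ : GeometricDivisorData K Kt, Thm62_geomHypotheses Γ) ↔ IsOfFSMType (FinSubextCat K Kt) := by
  refine ⟨fun h => ?_, fun hD Γ => Thm62_geomHypotheses_of_isOfFSMType hD Γ⟩
  by_contra hD
  obtain ⟨Γ, hΓ⟩ := exists_not_Thm62_geomHypotheses_of_not_isOfFSMType hD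
  exact hΓ (h Γ)

end Literature.AlgebraicGeometry.Frobenioids
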